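import Literature.MathematicalPhysics.QuantumFieldTheory.Balaban1983to89.B9Thm311FromEq3105Schur
import Literature.MathematicalPhysics.QuantumFieldTheory.Balaban1983to89.B9Thm310WholeDir

/-!
# `Balaban1983to89.B9Thm311FromEq3105Explicit` — T. Bałaban, *Propagators for lattice gauge theories in a background field*, Commun. Math.
# Phys. **99** (1985) 389–434 [Balaban1985BackgroundPropagators], THEOREM 3.11 p. 416 FOR `Δ_a` BY PRINT'S ROAD (`B9Thm311FromEq3105Schur`,
# p619203) WITH THE TWO IDENTITIES IT READS — (3.105) `Δ_a·G₀ = I − R` and its transpose — DISPLAYED instead of the schema `Identities310`;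
# corollary: the same theorem over dag-n06-c's direction-letter schema `B9Thm310WholeDir.Identities310₂` (R1′-A)

statement-level skeleton of published theorems with citation tags; proofs where landed; nothing here is a claim about the Yang–Mills mass gap

THE PRINT (p. 416, verbatim up to notation).  *«Theorem 3.11. Under the assumptions of the Theorems 3.1–3.10 (i.e. for M sufficiently large and α₀
sufficiently small) the operators Δ′_a, G′, (Q′G′²Q′\*)⁻¹, Δ_a, G are positive definite. … By (3.106) G = G₀(I − R)⁻¹, R is an operator with small
norm. … Thus we have to prove the positivity of G₀. By the definition (3.87) it is enough to prove a positivity of the operators G_□.»*; (3.105) p. 414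
*«Δ_aG₀ = I − R»*; (3.87) p. 409 *«G₀ = Σ_{□∈𝒟} h_□G_□h_□»*.

WHY THIS FILE (Track A of `YM-PLAN.md`, cell `pub-ymgap`, node N06; seat `pub-ymgap-dag-n06-d` g11, a count-neutral helper).  p619203's
`posDefEnd_deltaA_of_identities310` takes the rows-19 schema `hI : B9Thm310Whole.Identities310 𝔬 Rg H U` and reads exactly its two fields `eq3105 ∕
eq3105T`.  node00-def-Y's OBS-2 («slice obstruction») makes `Identities310` uninstantiable at the record letters (its `leibL` clause `PL_□ ∘ D`); the
R1′-A road (dag-n06-c) re-types rows 19 over `Identities310₂ 𝔬 𝔡 𝔩 R H U`, whose `inv ∕ invT ∕ eq3105 ∕ eq3105T` fields are byte-identical.  So the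
honest statement of Theorem 3.11's engine displays the two identities themselves: `posDefEnd_deltaA_of_eq3105` (p619203's theorem and PROOF verbatim,
`hI.eq3105 ↦ h105`, `hI.eq3105T ↦ h105T`), and both schema forms are one-line corollaries (`posDefEnd_deltaA_of_identities310₂` here; the v1 form is
p619203's own theorem).
HONEST SCOPE.  Finite-dimensional linear algebra on HYPOTHESIS SCHEMAS of printed shape, re-keyed; Cor. 3.6's positivity of the `G_□(U)` is NOT proved
(displayed), nor (3.89)∕(3.105) (displayed); nothing of [B9]'s estimates is asserted; one finite lattice at a time; NOT a node discharge; nothing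
continuum ∕ OS ∕ mass gap ∕ Clay.  0 `def`, 0 `sorry`.
-/

noncomputable section

namespace Literature.MathematicalPhysics.QuantumFieldTheory.Balaban1983to89.B9Thm311FromEq3105Explicit

open Literature.MathematicalPhysics.QuantumFieldTheory.Balaban1983to89
open Finset B6RandomWalk B9Thm34Ext B9Thm37Sum B9Thm37Glue
open Literature.MathematicalPhysics.QuantumFieldTheory.Balaban1983to89.B9Thm310Whole (Ops310 StaticOK310 Factors389 Identities310 Sizes310)
open Literature.MathematicalPhysics.QuantumFieldTheory.Balaban1983to89.B9Thm310WholeDir (DirLetters310 Identities310₂)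
open Literature.MathematicalPhysics.QuantumFieldTheory.Balaban1983to89.B9RWSums346SecondDiff (DirOps310)
open Literature.MathematicalPhysics.QuantumFieldTheory.Balaban1983to89.B9Thm312Whole (PosDefEnd)
open Literature.MathematicalPhysics.QuantumFieldTheory.Balaban1983to89.B9Thm311FromEq3105Schur
open scoped Matrix

/-! ## §1 ★★★ Theorem 3.11 for the letter `Δ_a`, the identities (3.105) ∕ (3.105)ᵀ displayed -/

section Main

variable {g : B9.Geometry} [Fintype g.Site] [DecidableEq g.Site] {B : B9.Backgrounds}
variable {X Y ι A : Type} [Fintype X] [DecidableEq X] [Fintype ι] [Fintype A]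

/-- ★★★ **THEOREM 3.11 FOR `Δ_a` ON THE WALK LETTERS OF THEOREM 3.10, ONE MEMBER, ONE `U`, THE IDENTITIES DISPLAYED** — p619203's
`B9Thm311FromEq3105Schur.posDefEnd_deltaA_of_identities310` VERBATIM (statement and proof) with the schema binder `hI : Identities310 𝔬 Rg H U` replaced by
the two equations it reads: `h105` = (3.105) `Δ_a·G₀ = 1 − Σ_aR_a` (`G₀ = Σ_i M_{h_i}G_iM_{h_i}`, (3.87)) and `h105T` = its transpose `G₀·Δ_a = 1 − Σ_aR♯_a`.  Print's
p. 416 proof: from the static data (`StaticOK310`: the factor overlap count `N_F`, `L^jη > 0`, `d ≥ 0`), the (3.89)-type factor majorants (`Factors389 … θ₀ δ₀ U`), the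
symmetry of `Δ_a(U)`, the LOCAL input «the operators G_□(U) are symmetric and positive» (positive semi-definite suffices), the level-gap letter
`L^jη ≤ Λe^{βd(y,y′)}L^{j′}η` ([4] (2.60)) and the (2.61) row sums at the rates `δ₀` and `δ₀ − β`, for «M sufficiently large» (`N_F·θ₀·(c + Λc′) < 2M`):
`Δ_a(U)` is positive definite (`B9Thm312Whole.PosDefEnd`).  Nothing of print asserted.
[cite: Balaban1985BackgroundPropagators, Thm 3.11 p.416 (statement and proof) + (3.105) p.414 + (3.87), (3.89) p.409; Balaban1984PropagatorsII, Lemma 2.1 (2.60)–(2.61) p.234, (2.51) p.232] -/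
theorem posDefEnd_deltaA_of_eq3105 (𝔬 : Ops310 g B X Y ι A) {Rg : ℝ} {H : Prop} {ρ N N' NF Cℓ : ℝ} {κ : Sizes310}
    (U : B.Cfg) (hs : StaticOK310 𝔬 ρ N N' NF Cℓ κ)
    (h105 : 𝔬.Δa U * (∑ i, mulOp (𝔬.h i) * 𝔬.Gsq U i * mulOp (𝔬.h i)) = 1 - ∑ a, 𝔬.Rf U a)
    (h105T : (∑ i, mulOp (𝔬.h i) * 𝔬.Gsq U i * mulOp (𝔬.h i)) * 𝔬.Δa U = 1 - ∑ a, 𝔬.Rt U a)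
    {θ₀ δ₀ : ℝ} (hF : Factors389 𝔬 Rg H θ₀ δ₀ U)
    (hθ₀ : 0 ≤ θ₀) (hM : 0 < g.M) {β Λ c c' : ℝ} (hΛ : 0 ≤ Λ)
    (hlen : ∀ y y' : g.Site, g.len y ≤ Λ * Real.exp (β * g.dist y y') * g.len y')
    (hrow : ∀ y : g.Site, ∑ y', Real.exp (-(δ₀ * g.dist y y')) ≤ c)
    (hrow' : ∀ y : g.Site, ∑ y', Real.exp (-((δ₀ - β) * g.dist y y')) ≤ c')
    (hbig : NF * θ₀ * (c + Λ * c') < 2 * g.M)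
    (hΔa : IsTransposePair (𝔬.Δa U) (𝔬.Δa U))
    (hGsq : ∀ i, IsTransposePair (𝔬.Gsq U i) (𝔬.Gsq U i)) (hGsq0 : ∀ i (v : X → ℝ), 0 ≤ v ⬝ᵥ 𝔬.Gsq U i v) :
    PosDefEnd (𝔬.Δa U) := by
  haveI : DecidableEq (toB6 g Rg H).Site := inferInstanceAs (DecidableEq g.Site)
  -- G₀, R, R♯
  set G₀ : Module.End ℝ (X → ℝ) := ∑ i, mulOp (𝔬.h i) * 𝔬.Gsq U i * mulOp (𝔬.h i) with hG₀
  have hG₀t : IsTransposePair G₀ G₀ := isTransposePair_localSum 𝔬.h (𝔬.Gsq U) hGsq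
  have hG₀nn : ∀ v : X → ℝ, 0 ≤ v ⬝ᵥ G₀ v := dotProduct_localSum_nonneg 𝔬.h (𝔬.Gsq U) hGsq0
  have h105' : 𝔬.Δa U * G₀ = 1 - ∑ a, 𝔬.Rf U a := h105
  have h105T' : G₀ * 𝔬.Δa U = 1 - ∑ a, 𝔬.Rt U a := h105T
  have hRt : IsTransposePair (∑ a, 𝔬.Rf U a) (∑ a, 𝔬.Rt U a) := isTransposePair_one_sub_mul hΔa hG₀t h105' h105T'
  -- the majorants of R and R♯
  have hKR : HasMajorant (g := toB6 g Rg H) 𝔬.blk (∑ a, 𝔬.Rf U a)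
      (fun y y' => ∑ a : A, (if y ∈ 𝔬.SF a then θ₀ * g.M⁻¹ * Real.exp (-(δ₀ * g.dist y y')) else 0)) :=
    hasMajorant_fintype_sum (g := toB6 g Rg H) 𝔬.blk hF.fac
  have hKRt : HasMajorant (g := toB6 g Rg H) 𝔬.blk (∑ a, 𝔬.Rt U a)
      (fun y y' => ∑ a : A, (if y' ∈ 𝔬.SF a then (1 : ℝ) else 0) * (θ₀ * g.M⁻¹) * (g.len y * (g.len y')⁻¹) *
        Real.exp (-(δ₀ * g.dist y y'))) :=
    hasMajorant_fintype_sum (g := toB6 g Rg H) 𝔬.blk hF.facT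
  -- the numerical radius of R
  have hnum : ∀ v : X → ℝ, v ⬝ᵥ (∑ a, 𝔬.Rf U a) v ≤ (NF * (θ₀ * g.M⁻¹) * c + NF * (θ₀ * g.M⁻¹) * Λ * c') / 2 * (v ⬝ᵥ v) :=
    fun v => (le_abs_self _).trans
      (abs_dotProduct_le_of_hasMajorant_pair (g := toB6 g Rg H) 𝔬.blk hKR hKRt hRt
        (fun x => rowSum_fac_le 𝔬 hs hθ₀ hM hrow (𝔬.blk x))
        (fun x => rowSum_facT_le 𝔬 hs hθ₀ hM hΛ hlen hrow' (𝔬.blk x)) v)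
  -- «M sufficiently large»: the radius is < 1
  have hθ : (NF * (θ₀ * g.M⁻¹) * c + NF * (θ₀ * g.M⁻¹) * Λ * c') / 2 < 1 := by
    have h1 : (NF * (θ₀ * g.M⁻¹) * c + NF * (θ₀ * g.M⁻¹) * Λ * c') / 2 = NF * θ₀ * (c + Λ * c') / (2 * g.M) := by
      field_simp
    rw [h1, div_lt_one (by linarith)]
    exact hbig
  exact posDefEnd_of_mul_eq_one_sub_of_psd hΔa h105' hG₀nn hθ hnum

/-- ★ **THEOREM 3.11 FOR `Δ_a` OVER THE DIRECTION-LETTER SCHEMA (R1′-A)**: the same statement with dag-n06-c's `Identities310₂ 𝔬 𝔡 𝔩 Rg H U`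
(`B9Thm310WholeDir`; the Laplacian-Leibniz clause read over per-direction letters `𝔩 : DirLetters310`, every other field — in particular
`eq3105 ∕ eq3105T` — byte-identical to `Identities310`) in place of p619203's `Identities310`.  One line over `posDefEnd_deltaA_of_eq3105`.
[cite: Balaban1985BackgroundPropagators, Thm 3.11 p.416 + (3.105) p.414 + (3.87) p.409; Balaban1984PropagatorsII, Lemma 2.1 (2.60)–(2.61) p.234] -/
theorem posDefEnd_deltaA_of_identities310₂ {Dir : Type} [Fintype Dir] (𝔬 : Ops310 g B X Y ι A) (𝔡 : DirOps310 𝔬 Dir) (𝔩 : DirLetters310 𝔬 Dir)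
    {Rg : ℝ} {H : Prop} {ρ N N' NF Cℓ : ℝ} {κ : Sizes310}
    (U : B.Cfg) (hs : StaticOK310 𝔬 ρ N N' NF Cℓ κ) (hI : Identities310₂ 𝔬 𝔡 𝔩 Rg H U) {θ₀ δ₀ : ℝ} (hF : Factors389 𝔬 Rg H θ₀ δ₀ U)
    (hθ₀ : 0 ≤ θ₀) (hM : 0 < g.M) {β Λ c c' : ℝ} (hΛ : 0 ≤ Λ)
    (hlen : ∀ y y' : g.Site, g.len y ≤ Λ * Real.exp (β * g.dist y y') * g.len y')
    (hrow : ∀ y : g.Site, ∑ y', Real.exp (-(δ₀ * g.dist y y')) ≤ c)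
    (hrow' : ∀ y : g.Site, ∑ y', Real.exp (-((δ₀ - β) * g.dist y y')) ≤ c')
    (hbig : NF * θ₀ * (c + Λ * c') < 2 * g.M)
    (hΔa : IsTransposePair (𝔬.Δa U) (𝔬.Δa U))
    (hGsq : ∀ i, IsTransposePair (𝔬.Gsq U i) (𝔬.Gsq U i)) (hGsq0 : ∀ i (v : X → ℝ), 0 ≤ v ⬝ᵥ 𝔬.Gsq U i v) :
    PosDefEnd (𝔬.Δa U) :=
  posDefEnd_deltaA_of_eq3105 𝔬 U hs hI.eq3105 hI.eq3105T hF hθ₀ hM hΛ hlen hrow hrow' hbig hΔa hGsq hGsq0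

end Main

end Literature.MathematicalPhysics.QuantumFieldTheory.Balaban1983to89.B9Thm311FromEq3105Explicit

end
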